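import Mathlib.Analysis.Normed.Group.FunctionSeries
import Mathlib.Analysis.Complex.Basic
import Mathlib.Topology.Algebra.InfiniteSum.Constructions
import Mathlib.Topology.Algebra.InfiniteSum.NatInt
import Mathlib.Topology.Order.DenselyOrdered

/-!
# `StokesGeneration` (stmt-KontsevichZagierPeriods-3586), line `Sketch`, stub `stub_germToOan` — part 1:
the identity theorem for power series on the closed unit cube

Support file (pure Mathlib) for the registered stub `stub_germToOan` (dictionary, analytic half)
of the crux `StokesGeneration` (route UnfoldedStokes, line `Sketch` = card cube-type-a-generation).

A power series `Σ_b g(b) x^b` in `N` real variables with complex coefficients and `Σ_b ‖g(b)‖ < ∞`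
converges absolutely on the closed unit cube `[0,1]ᴺ`; if its sum vanishes at every point of the
cube then `g = 0` (`eq_zero_of_tsum_mul_prod_pow_eq_zero`). One variable
(`eq_zero_of_tsum_mul_pow_eq_zero`): the shifted sums `S_m(t) = Σ_k g(k+m) tᵏ` are continuous on
`[0,1]` (normal convergence) and satisfy `S_m(t) = g(m) + t S_{m+1}(t)`; if `S_m` vanishes on
`(0,1]` it vanishes at `0` by continuity, so `g(m) = S_m(0) = 0` and `S_{m+1}` vanishes on `(0,1]`;
induction on `m`. Several variables: peel off the first coordinate (`Fin.cons`), the inner sums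
being an absolutely summable family in the exponent of the first variable (Fubini for absolutely
convergent double series), and induct on `N`.

This is the uniqueness half of the dictionary between real germs on the cube and Ayoub's series
`𝒪_{ℚ̄-alg}(𝔻̄^∞)` (J. Ayoub, EMS Newsl. 91 (2014) §2.2, Rem. 13): a polynomial identity satisfied by
the SUM of the germ on the cube is satisfied by the SERIES.
-/

noncomputable section

-- `Summit.KontsevichZagierPeriods.KontsevichZagierPeriods.…` is the tree's mandated layout (single-conjunct summit).
set_option linter.dupNamespace false

namespace Summit.KontsevichZagierPeriods.KontsevichZagierPeriods.StokesGenerationLine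

open Set Filter
open scoped Topology

/-- A real monomial `∏ⱼ xⱼ^{bⱼ}` at a point of the closed unit cube has modulus `≤ 1` (as a complex
number). [folklore] -/
theorem norm_prod_ofReal_pow_le_one {N : ℕ} (x : Fin N → ℝ) (hx : ∀ j, x j ∈ Icc (0:ℝ) 1)
    (b : Fin N → ℕ) : ‖∏ j, ((x j : ℝ) : ℂ) ^ (b j)‖ ≤ 1 := by
  rw [norm_prod]
  refine Finset.prod_le_one (fun j _ => norm_nonneg _) fun j _ => ?_
  rw [norm_pow, Complex.norm_real, Real.norm_of_nonneg (hx j).1]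
  exact pow_le_one₀ (hx j).1 (hx j).2

/-- **Identity theorem on `[0,1]`, one variable.** If `Σ_k ‖g k‖ < ∞` and `Σ_k g(k) tᵏ = 0` for
every `t ∈ [0,1]`, then `g = 0`. (The shifted sums `S_m(t) = Σ_k g(k+m) tᵏ` are continuous on `[0,1]`;
`S_m ≡ 0` on `(0,1]` forces `g m = S_m(0) = 0` and `S_{m+1} ≡ 0` on `(0,1]`.) [folklore] -/
theorem eq_zero_of_tsum_mul_pow_eq_zero (g : ℕ → ℂ) (hg : Summable fun k => ‖g k‖)
    (h0 : ∀ t : ℝ, t ∈ Icc (0:ℝ) 1 → ∑' k, g k * (t : ℂ) ^ k = 0) : ∀ k, g k = 0 := by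
  have hsum : ∀ m, Summable fun k => ‖g (k + m)‖ := fun m =>
    (summable_nat_add_iff m).2 hg
  have hbd : ∀ m (t : ℝ), t ∈ Icc (0:ℝ) 1 → ∀ k, ‖g (k + m) * (t : ℂ) ^ k‖ ≤ ‖g (k + m)‖ := by
    intro m t ht k
    rw [norm_mul, norm_pow, Complex.norm_real, Real.norm_of_nonneg ht.1]
    exact mul_le_of_le_one_right (norm_nonneg _) (pow_le_one₀ ht.1 ht.2)
  have hsumt : ∀ m (t : ℝ), t ∈ Icc (0:ℝ) 1 → Summable fun k => g (k + m) * (t : ℂ) ^ k :=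
    fun m t ht => Summable.of_norm_bounded (hsum m) (hbd m t ht)
  have hcont : ∀ m, ContinuousOn (fun t : ℝ => ∑' k, g (k + m) * (t : ℂ) ^ k) (Icc 0 1) := by
    intro m
    refine continuousOn_tsum (fun k => ?_) (hsum m) fun k t ht => hbd m t ht k
    exact (continuous_const.mul (Complex.continuous_ofReal.pow k)).continuousOn
  -- vanishing on `(0,1]` forces the constant term to vanish (continuity at `0`)
  have hzero : ∀ m, (∀ t : ℝ, t ∈ Ioc (0:ℝ) 1 → ∑' k, g (k + m) * (t : ℂ) ^ k = 0) →
      g m = 0 := by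
    intro m hm
    have heq : EqOn (fun t : ℝ => ∑' k, g (k + m) * (t : ℂ) ^ k) (fun _ => (0 : ℂ)) (Icc 0 1) :=
      (show EqOn (fun t : ℝ => ∑' k, g (k + m) * (t : ℂ) ^ k) (fun _ => (0 : ℂ)) (Ioc 0 1) from
        fun t ht => hm t ht).of_subset_closure (hcont m) continuousOn_const
        Ioc_subset_Icc_self (by rw [closure_Ioc zero_ne_one])
    have h00 := heq (left_mem_Icc.2 zero_le_one)
    simp only [Complex.ofReal_zero] at h00
    rw [tsum_eq_single 0] at h00
    · simpa using h00
    · intro k hk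
      simp [zero_pow hk]
  -- induction on the shift
  have key : ∀ m, ∀ t : ℝ, t ∈ Ioc (0:ℝ) 1 → ∑' k, g (k + m) * (t : ℂ) ^ k = 0 := by
    intro m
    induction m with
    | zero =>
      intro t ht
      simpa using h0 t ⟨ht.1.le, ht.2⟩
    | succ m ih =>
      have hgm : g m = 0 := hzero m ih
      intro t ht
      have hsplit := (hsumt m t ⟨ht.1.le, ht.2⟩).tsum_eq_zero_add
      rw [ih t ht] at hsplit
      simp only [zero_add, pow_zero, mul_one, hgm] at hsplit
      have h2 : ∑' k, g (k + 1 + m) * (t : ℂ) ^ (k + 1) =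
          (t : ℂ) * ∑' k, g (k + (m + 1)) * (t : ℂ) ^ k := by
        rw [← tsum_mul_left]
        refine tsum_congr fun k => ?_
        rw [show k + 1 + m = k + (m + 1) by omega, pow_succ]
        ring
      rw [h2] at hsplit
      have ht0 : (t : ℂ) ≠ 0 := Complex.ofReal_ne_zero.2 ht.1.ne'
      simpa [ht0] using hsplit.symm
  exact fun k => hzero k (key k)

/-- **Identity theorem on the closed unit cube, `N` variables.** If `Σ_b ‖g b‖ < ∞`
(`b : Fin N → ℕ`) and `Σ_b g(b) ∏ⱼ xⱼ^{bⱼ} = 0` for every `x ∈ [0,1]ᴺ`, then `g = 0`. (Peel off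
the first variable: for fixed `x'` the inner sums `G_k(x') = Σ_{b'} g(k ∷ b') x'^{b'}` form an
absolutely summable family with `Σ_k G_k(x') tᵏ = 0` on `[0,1]`, so they vanish by the one-variable
case; induct on `N`.) [folklore] -/
theorem eq_zero_of_tsum_mul_prod_pow_eq_zero :
    ∀ (N : ℕ) (g : (Fin N → ℕ) → ℂ), Summable (fun b => ‖g b‖) →
      (∀ x : Fin N → ℝ, (∀ j, x j ∈ Icc (0:ℝ) 1) →
        ∑' b, g b * ∏ j, ((x j : ℝ) : ℂ) ^ (b j) = 0) →
      ∀ b, g b = 0 := by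
  intro N
  induction N with
  | zero =>
    intro g _ h b
    have h0 := h (fun j => j.elim0) (fun j => j.elim0)
    rw [tsum_eq_single b] at h0
    · simpa using h0
    · intro b' hb'
      exact absurd (Subsingleton.elim b' b) hb'
  | succ N ih =>
    intro g hg h b
    set e : ℕ × (Fin N → ℕ) ≃ (Fin (N + 1) → ℕ) := Fin.consEquiv (fun _ => ℕ) with he
    have hg' : Summable fun p : ℕ × (Fin N → ℕ) => ‖g (Fin.cons p.1 p.2)‖ :=
      (e.summable_iff (f := fun b => ‖g b‖)).2 hg
    have hgk : ∀ k : ℕ, Summable fun b' : Fin N → ℕ => ‖g (Fin.cons k b')‖ := fun k =>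
      hg'.prod_factor k
    -- the inner sums vanish on the cube
    have hinner : ∀ k : ℕ, ∀ x' : Fin N → ℝ, (∀ j, x' j ∈ Icc (0:ℝ) 1) →
        ∑' b', g (Fin.cons k b') * ∏ j, ((x' j : ℝ) : ℂ) ^ (b' j) = 0 := by
      intro k x' hx'
      -- the family `k ↦ G_k(x')`
      have hGbd : ∀ k, ‖∑' b', g (Fin.cons k b') * ∏ j, ((x' j : ℝ) : ℂ) ^ (b' j)‖ ≤
          ∑' b', ‖g (Fin.cons k b')‖ := fun k => by
        refine (norm_tsum_le_tsum_norm ?_).trans (Summable.tsum_le_tsum (fun b' => ?_) ?_ (hgk k))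
        · exact (hgk k).of_nonneg_of_le (fun _ => norm_nonneg _) fun b' => by
            rw [norm_mul]
            exact mul_le_of_le_one_right (norm_nonneg _) (norm_prod_ofReal_pow_le_one x' hx' b')
        · rw [norm_mul]
          exact mul_le_of_le_one_right (norm_nonneg _) (norm_prod_ofReal_pow_le_one x' hx' b')
        · exact (hgk k).of_nonneg_of_le (fun _ => norm_nonneg _) fun b' => by
            rw [norm_mul]
            exact mul_le_of_le_one_right (norm_nonneg _) (norm_prod_ofReal_pow_le_one x' hx' b')
      have hGsum : Summable fun k =>
          ‖∑' b', g (Fin.cons k b') * ∏ j, ((x' j : ℝ) : ℂ) ^ (b' j)‖ :=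
        (hg'.prod).of_nonneg_of_le (fun _ => norm_nonneg _) hGbd
      refine eq_zero_of_tsum_mul_pow_eq_zero _ hGsum (fun t ht => ?_) k
      -- evaluate the full series at `t ∷ x'`
      have hx : ∀ j, (Fin.cons t x' : Fin (N + 1) → ℝ) j ∈ Icc (0:ℝ) 1 := fun j =>
        Fin.cases (by simpa using ht) (fun i => by simpa using hx' i) j
      have h1 := h (Fin.cons t x') hx
      rw [← e.tsum_eq] at h1
      have he' : ∀ p : ℕ × (Fin N → ℕ), e p = Fin.cons p.1 p.2 := fun p => rfl
      have hmono : ∀ p : ℕ × (Fin N → ℕ),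
          g (e p) * ∏ j, (((Fin.cons t x' : Fin (N + 1) → ℝ) j : ℝ) : ℂ) ^ (e p j) =
            g (Fin.cons p.1 p.2) * (∏ j, ((x' j : ℝ) : ℂ) ^ (p.2 j)) * (t : ℂ) ^ p.1 := by
        intro p
        rw [he', Fin.prod_univ_succ]
        simp only [Fin.cons_zero, Fin.cons_succ]
        ring
      simp only [hmono] at h1
      have hsum2 : Summable fun p : ℕ × (Fin N → ℕ) =>
          g (Fin.cons p.1 p.2) * (∏ j, ((x' j : ℝ) : ℂ) ^ (p.2 j)) * (t : ℂ) ^ p.1 := by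
        refine Summable.of_norm_bounded hg' fun p => ?_
        rw [norm_mul, norm_mul, mul_assoc]
        refine mul_le_of_le_one_right (norm_nonneg _)
          (mul_le_one₀ (norm_prod_ofReal_pow_le_one x' hx' p.2) (norm_nonneg _) ?_)
        rw [norm_pow, Complex.norm_real, Real.norm_of_nonneg ht.1]
        exact pow_le_one₀ ht.1 ht.2
      rw [hsum2.tsum_prod] at h1
      rw [← h1]
      refine tsum_congr fun k => ?_
      rw [← tsum_mul_right]
    -- conclude by the induction hypothesis on each slice
    have hslice : ∀ k : ℕ, ∀ b', g (Fin.cons k b') = 0 := fun k =>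
      ih (fun b' => g (Fin.cons k b')) (hgk k) (hinner k)
    rw [← Fin.cons_self_tail b]
    exact hslice (b 0) (Fin.tail b)

/-- **Registered auxiliary stub** `stub_germToOanAuxIdentity` (sub-goal of `stub_germToOan`, crux
stmt-KontsevichZagierPeriods-3586): the identity theorem for absolutely summable power series on the
closed unit cube `[0,1]ᴺ`, in the form registered on the ledger
(= `eq_zero_of_tsum_mul_prod_pow_eq_zero`). [folklore] -/
theorem stub_germToOanAuxIdentity :
    ∀ (N : ℕ) (g : (Fin N → ℕ) → ℂ), Summable (fun b => ‖g b‖) →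
      (∀ x : Fin N → ℝ, (∀ j, x j ∈ Set.Icc (0:ℝ) 1) →
        ∑' b, g b * ∏ j, ((x j : ℝ) : ℂ) ^ (b j) = 0) → ∀ b, g b = 0 :=
  eq_zero_of_tsum_mul_prod_pow_eq_zero

/-- **Identity theorem on the closed unit cube, exponents as `Fin N →₀ ℕ`** (the indexing used by
the crux stubs): if `Σₐ ‖g a‖ < ∞` and `Σₐ g(a) ∏ⱼ xⱼ^{aⱼ} = 0` for every `x ∈ [0,1]ᴺ`, then `g = 0`
(transport of `eq_zero_of_tsum_mul_prod_pow_eq_zero` along `Finsupp.equivFunOnFinite`). [folklore] -/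
theorem eq_zero_of_tsum_mul_prod_pow_eq_zero_finsupp (N : ℕ) (g : (Fin N →₀ ℕ) → ℂ)
    (hg : Summable fun a => ‖g a‖)
    (h : ∀ x : Fin N → ℝ, (∀ j, x j ∈ Set.Icc (0:ℝ) 1) →
      ∑' a, g a * ∏ j, ((x j : ℝ) : ℂ) ^ (a j) = 0) :
    ∀ a, g a = 0 := by
  set e := (Finsupp.equivFunOnFinite : (Fin N →₀ ℕ) ≃ (Fin N → ℕ)) with he
  have hg' : Summable fun b : Fin N → ℕ => ‖g (e.symm b)‖ :=
    (e.symm.summable_iff (f := fun a => ‖g a‖)).2 hg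
  have h' : ∀ x : Fin N → ℝ, (∀ j, x j ∈ Set.Icc (0:ℝ) 1) →
      ∑' b, g (e.symm b) * ∏ j, ((x j : ℝ) : ℂ) ^ (b j) = 0 := fun x hx =>
    (e.symm.tsum_eq (fun a => g a * ∏ j, ((x j : ℝ) : ℂ) ^ (a j))).trans (h x hx)
  intro a
  have := eq_zero_of_tsum_mul_prod_pow_eq_zero N (fun b => g (e.symm b)) hg' h' (e a)
  simpa [he] using this

end Summit.KontsevichZagierPeriods.KontsevichZagierPeriods.StokesGenerationLine
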